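import Literature.NumberTheory.Automorphic.SplitTorusOrderCyclicLattices        -- ★ O7 (F0P3b-p01 (g11)): `O[γ]` is a ring (`mul_mem_span_pow`, `inv_mem_span_pow`, `eval_mem_span_pow_of_mem`), the criterion vector `T(a)`
import Literature.NumberTheory.LocalFields.UnramifiedQuadraticNormAtInertPlace  -- ★ `exists_mul_map_eq_of_isUnit_integer` («`U_K = N U_L`» on `𝒪[E]`, `ValuativeRel` currency)
import HarnessLib

/-!
# T3′ organ O8a, EXISTENCE HALF: the self-dual cyclic `O[γ]`-lattices form a NON-EMPTY `C`-torsor exactly on the parity class — the symmetrisation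
# `f′(γ) = s · λ` and the norm equation `d_i s_i · a_i σ(a_i) = 1` (Serre, *Local Fields*, Ch. V §2 Prop. 3; Jacobowitz 1962 §4; Rogawski 1990 §4.9)

Topic `NumberTheory/Automorphic`; namespace `Literature.NumberTheory.Automorphic`.  THEOREMS ONLY (no definition, no instance, no notation, no named fact, no `sorry`).
Cell `pub/hodgecm-mathlib` (D-0151), crux H413 = `stmt-HodgeConjecture-24833`, road «S3-tree», brick T3′ «DEPTH-ZERO κ-TRANSFER» (holder F0P3b-p01 (g11), DESIGN v1
419b4e54 §1–§2), organ **O8a-∃** (architect A-p16 (g29) A-65 (1) → A-p19 (g25)): in O7's tokens (★ `SplitTorusOrderCyclicLattices`: `R := span_O {(γ_i^j)_i}` INLINE,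
`f′(γ)_i := ∏_{j ≠ i} (γ_i − γ_j)`, criterion vector `T(a)_i := d_i · a_i σ(a_i) · f′(γ)_i`, good set `{a | T(a) ∈ R, unit components}` = ONE `C`-coset or `∅`).
HONEST LABEL: HC_CM is proved only modulo the printed citations (2 remaining named inputs hLiu418 24832, h413 24833) until rung 0 closes; generic algebra + ★ norm surjectivity.

THE MATHEMATICS.  `K` a field with an involution `σ` preserving the subring `O`, `γ : Fin n → K` NORM-ONE nodes (`σ γ_i = γ_i⁻¹`, `γ_i ∈ O`) with `1 + γ_i ∈ O^×` (residually
unipotent `γ` at a place with `2 ∈ O^×`), `δ ∈ O^×` skew (`σδ = −δ`; unramified `E ∕ F` away from `2`), `d_i` σ-fixed (the diagonal Gram values of an `h`-orthogonal eigenframe).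
(§1 SYMMETRISATION) the Cayley quotients `x_ij := (γ_i − γ_j) ∕ ((1+γ_i)(1+γ_j))` are SKEW (`σ x_ij = −x_ij`), so `s_ij := x_ij ∕ δ` is σ-fixed and
  `γ_i − γ_j = s_ij · (1+γ_i)(1+γ_j) δ`,  whence  **`f′(γ)_i = s_i · λ_i`**,  `s_i := ∏_{j≠i} s_ij ∈ K^σ`,  `λ_i := ∏_{j≠i} (1+γ_i)(1+γ_j)δ = ((1+γ_i)δ)^{n−1} ∏_{j≠i}(1+γ_j)`,
and `λ = (((1+γ)δ)^{n−1}) · (P₀ · (1+γ)⁻¹)` (`P₀ := ∏_j (1+γ_j) ∈ O`) lies in `R` with UNIT components (★ O7 ring calculus: `(1+γ) ∈ R`, `(1+γ)⁻¹ ∈ R`).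
(§2 REDUCTION) `T(a) = (d_i · a_iσ(a_i) · s_i)_i · λ`, so the good set is non-empty as soon as the `n` NORM EQUATIONS `a_i σ(a_i) · (d_i s_i) = 1` are solvable (then `T(a) = λ ∈ R^×`);
conversely a good `a` makes every `d_i s_i · a_iσ(a_i)` a unit of `O`.
(§3 THE NORM EQUATIONS at an unramified place, `ValuativeRel` currency of (D0)) for `E` a valued field, `σ` preserving `𝒪[E]` and moving some integer by a unit (`σ̄ ≠ id`:
INERT), `ϖ` a σ-FIXED uniformiser-like element: a σ-fixed `x ≠ 0` with `v(x) = v(ϖ^{2k})` is a norm `b σ(b)` (★ «`U_K = N U_L`» `exists_mul_map_eq_of_isUnit_integer` on the unit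
`x ∕ ϖ^{2k}`, times `ϖ^k σ(ϖ^k) = ϖ^{2k}`); so when `v(d_i) + v(f′(γ)_i)` is EVEN for every `i` (`v(λ_i) = 0`), the good set is non-empty — DESIGN §1 «non-empty ⟺ `v(h₀,i) +
v(f′(γ)_i)` even», the existence half; the count half `#(good set ∕ R^×) = [C : R^×] = (q+1)^{n−1} q^{S−n+1}` is O7's torsor + ★ O3∕O4 (`QuadraticInvolutionDescentIndex`) + O1∕O2.

* §1 `cayleyQuotient_skew`, `sub_eq_symm_mul`, `nodalDeriv_eq_symm_mul`, `symm_fixed`, `symmFactor_mem_span_pow`, `symmFactor_units`.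
* §2 `criterion_eq_normSymm_mul`, **`exists_criterion_of_norm_solutions`** (O8a-∃, abstract norm hypothesis), `isUnit_normSymm_of_criterion` (converse).
* §3 `exists_mul_map_eq_of_valuation_eq_even` (σ-fixed elements of even valuation are norms at an inert place), **`exists_norm_solution_of_even`** (the norm equations from parity),
  and their `zpow` twins `…_zpow_even` (`k : ℤ`: the parity class has no sign).

## References
* [Serre1979] J.-P. Serre, *Local Fields*, GTM 67 (1979): Ch. V §2 Prop. 3, Corollary, Remark 1 (`U_K = N U_L`, `K^×∕N L^×` of order `f = 2`: norms = even valuation).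
* [Jacobowitz1962] R. Jacobowitz, *Hermitian forms over local fields*, Amer. J. Math. 84 (1962): §4 (scaling of hermitian lattices, Gram criteria).
* [Rogawski1990] J. D. Rogawski, *Automorphic Representations of Unitary Groups in Three Variables* (1990): §4.9 p. 54 (where the lattice count is consumed).
-/

set_option autoImplicit false

open Polynomial Finset

namespace Literature.NumberTheory.Automorphic

/-! ## §1 Symmetrisation of the nodal derivative for norm-one nodes -/

section Symmetrisation

variable {K : Type*} [Field K] {n : ℕ} (O : Subring K) (σ : K →+* K) {γ : Fin n → K}

/-- **THE CAYLEY QUOTIENT OF TWO NORM-ONE NODES IS SKEW**: `σ((γ_i − γ_j)∕((1+γ_i)(1+γ_j))) = −(γ_i − γ_j)∕((1+γ_i)(1+γ_j))` when `σ γ = γ⁻¹` and `γ, 1+γ ≠ 0`.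
[cite: Jacobowitz1962, §4] [cite: Rogawski1990, §4.9 p. 54] -/
theorem cayleyQuotient_skew (hσγ : ∀ i, σ (γ i) = (γ i)⁻¹) (hγ0 : ∀ i, γ i ≠ 0) (i j : Fin n) :
    σ ((γ i - γ j) / ((1 + γ i) * (1 + γ j))) = -((γ i - γ j) / ((1 + γ i) * (1 + γ j))) := by
  have hi := hγ0 i; have hj := hγ0 j
  have hA : (γ i)⁻¹ - (γ j)⁻¹ = -(γ i - γ j) / (γ i * γ j) := by
    field_simp
    ring
  have hB : (1 + (γ i)⁻¹) * (1 + (γ j)⁻¹) = ((1 + γ i) * (1 + γ j)) / (γ i * γ j) := by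
    field_simp
    ring
  rw [map_div₀, map_sub, map_mul, map_add, map_add, map_one, hσγ, hσγ, hA, hB, div_div_div_cancel_right₀ (mul_ne_zero hi hj), neg_div]

/-- **`γ_i − γ_j = s_ij · ((1+γ_i)(1+γ_j)δ)`** with `s_ij := (γ_i − γ_j)∕((1+γ_i)(1+γ_j)δ)` (trivial rearrangement, `δ ≠ 0`). [cite: Jacobowitz1962, §4] -/
theorem sub_eq_symm_mul {δ : K} (hδ0 : δ ≠ 0) (hγ1 : ∀ i, 1 + γ i ≠ 0) (i j : Fin n) :
    γ i - γ j = (γ i - γ j) / ((1 + γ i) * (1 + γ j) * δ) * ((1 + γ i) * (1 + γ j) * δ) := by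
  rw [div_mul_cancel₀ _ (mul_ne_zero (mul_ne_zero (hγ1 i) (hγ1 j)) hδ0)]

/-- **`s_ij` IS σ-FIXED** for a skew unit `δ` (`σδ = −δ`): skew ∕ skew = fixed. [cite: Serre1979, Ch. V §2] -/
theorem symm_fixed (hσγ : ∀ i, σ (γ i) = (γ i)⁻¹) (hγ0 : ∀ i, γ i ≠ 0) {δ : K} (hσδ : σ δ = -δ) (i j : Fin n) :
    σ ((γ i - γ j) / ((1 + γ i) * (1 + γ j) * δ)) = (γ i - γ j) / ((1 + γ i) * (1 + γ j) * δ) := by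
  rw [← div_div, map_div₀, cayleyQuotient_skew σ hσγ hγ0, hσδ, neg_div_neg_eq]

/-- **`f′(γ)_i = s_i · λ_i`**: `∏_{j≠i}(γ_i − γ_j) = (∏_{j≠i} s_ij) · ∏_{j≠i} ((1+γ_i)(1+γ_j)δ)`. [cite: Jacobowitz1962, §4] [cite: Serre1979, Ch. III §6] -/
theorem nodalDeriv_eq_symm_mul {δ : K} (hδ0 : δ ≠ 0) (hγ1 : ∀ i, 1 + γ i ≠ 0) (i : Fin n) :
    ∏ j ∈ univ.erase i, (γ i - γ j) =
      (∏ j ∈ univ.erase i, (γ i - γ j) / ((1 + γ i) * (1 + γ j) * δ)) * ∏ j ∈ univ.erase i, ((1 + γ i) * (1 + γ j) * δ) := by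
  rw [← Finset.prod_mul_distrib]
  exact Finset.prod_congr rfl fun j _ => sub_eq_symm_mul hδ0 hγ1 i j

/-- `σ` fixes `s_i = ∏_{j≠i} s_ij`. [cite: Serre1979, Ch. V §2] -/
theorem symmProd_fixed (hσγ : ∀ i, σ (γ i) = (γ i)⁻¹) (hγ0 : ∀ i, γ i ≠ 0) {δ : K} (hσδ : σ δ = -δ) (i : Fin n) :
    σ (∏ j ∈ univ.erase i, (γ i - γ j) / ((1 + γ i) * (1 + γ j) * δ)) = ∏ j ∈ univ.erase i, (γ i - γ j) / ((1 + γ i) * (1 + γ j) * δ) := by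
  rw [map_prod]
  exact Finset.prod_congr rfl fun j _ => symm_fixed σ hσγ hγ0 hσδ i j

/-- **`λ_i = ((1+γ_i)δ)^{n−1} · ∏_{j≠i}(1+γ_j)`** — the closed form of `∏_{j≠i}((1+γ_i)(1+γ_j)δ)`. [cite: Serre1979, Ch. III §6] -/
theorem symmFactor_eq (δ : K) (i : Fin n) :
    ∏ j ∈ univ.erase i, ((1 + γ i) * (1 + γ j) * δ) = ((1 + γ i) * δ) ^ (n - 1) * ∏ j ∈ univ.erase i, (1 + γ j) := by
  have hcard : (univ.erase i).card = n - 1 := by rw [Finset.card_erase_of_mem (Finset.mem_univ i), Finset.card_univ, Fintype.card_fin]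
  rw [show (fun j => (1 + γ i) * (1 + γ j) * δ) = fun j => ((1 + γ i) * δ) * (1 + γ j) from funext fun j => by ring, Finset.prod_mul_distrib,
    Finset.prod_const, hcard]

/-- `∏_{j≠i}(1+γ_j) = (∏_j (1+γ_j)) · (1+γ_i)⁻¹`. [cite: Serre1979, Ch. III §6] -/
theorem prod_erase_one_add_eq (hγ1 : ∀ i, 1 + γ i ≠ 0) (i : Fin n) :
    ∏ j ∈ univ.erase i, (1 + γ j) = (∏ j, (1 + γ j)) * (1 + γ i)⁻¹ := by
  rw [← Finset.mul_prod_erase univ (fun j => 1 + γ j) (Finset.mem_univ i), mul_comm ((1 : K) + γ i), mul_assoc, mul_inv_cancel₀ (hγ1 i), mul_one]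

/-- **`λ ∈ R = O[γ]`**: the symmetrisation factor `λ = ((1+γ)δ)^{n−1} · P₀ · (1+γ)⁻¹` lies in the order (★ O7: `1 + γ ∈ R`, powers, the inverse of an element with unit
components, scalars `δ, P₀ ∈ O`). [cite: Serre1979, Ch. III §6] [cite: Jacobowitz1962, §4] -/
theorem symmFactor_mem_span_pow (hγ : ∀ i, γ i ∈ O) (hγ1u : ∀ i, ∃ y ∈ O, y * (1 + γ i) = 1) {δ : K} (hδ : δ ∈ O) :
    (fun i => ∏ j ∈ univ.erase i, ((1 + γ i) * (1 + γ j) * δ)) ∈ Submodule.span O (Set.range fun j : Fin n => fun i => γ i ^ (j : ℕ)) := by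
  have hγ1 : ∀ i, 1 + γ i ≠ 0 := fun i h0 => by
    obtain ⟨y, -, hy⟩ := hγ1u i; rw [h0, mul_zero] at hy; exact zero_ne_one hy
  -- `1 + γ ∈ R`
  have h1γ : (fun i => 1 + γ i) ∈ Submodule.span O (Set.range fun j : Fin n => fun i => γ i ^ (j : ℕ)) := by
    have h := eval_mem_span_pow O hγ (1 + X : O[X])
    have he : (fun i => ((1 + X : O[X]).map O.subtype).eval (γ i)) = fun i => 1 + γ i := by
      funext i; simp
    rwa [he] at h
  -- `((1 + γ) δ)^{n-1} ∈ R`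
  have hA : (fun i => ((1 + γ i) * δ) ^ (n - 1)) ∈ Submodule.span O (Set.range fun j : Fin n => fun i => γ i ^ (j : ℕ)) := by
    have hsm : (fun i => (1 + γ i) * δ) = (⟨δ, hδ⟩ : O) • (fun i => 1 + γ i) := by
      funext i; simp only [Pi.smul_apply, Subring.smul_def, smul_eq_mul]; ring
    have hmem : (fun i => (1 + γ i) * δ) ∈ Submodule.span O (Set.range fun j : Fin n => fun i => γ i ^ (j : ℕ)) := by
      rw [hsm]; exact Submodule.smul_mem _ _ h1γ
    have := pow_mem_span_pow O hγ hmem (n - 1)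
    exact this
  -- `P₀ · (1+γ)⁻¹ ∈ R`
  have hB : (fun i => ∏ j ∈ univ.erase i, (1 + γ j)) ∈ Submodule.span O (Set.range fun j : Fin n => fun i => γ i ^ (j : ℕ)) := by
    have hinv := inv_mem_span_pow O hγ h1γ hγ1u
    have hP0 : (∏ j, (1 + γ j)) ∈ O := Subring.prod_mem _ fun j _ => O.add_mem O.one_mem (hγ j)
    have heq : (fun i => ∏ j ∈ univ.erase i, (1 + γ j)) = (⟨∏ j, (1 + γ j), hP0⟩ : O) • (fun i => 1 + γ i)⁻¹ := by
      funext i; rw [prod_erase_one_add_eq hγ1 i]; simp [Subring.smul_def]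
    rw [heq]; exact Submodule.smul_mem _ _ hinv
  have hprod := mul_mem_span_pow O hγ hA hB
  have heq : (fun i => ∏ j ∈ univ.erase i, ((1 + γ i) * (1 + γ j) * δ)) = (fun i => ((1 + γ i) * δ) ^ (n - 1)) * fun i => ∏ j ∈ univ.erase i, (1 + γ j) := by
    funext i; rw [Pi.mul_apply, symmFactor_eq]
  rw [heq]; exact hprod

/-- **`λ` HAS UNIT COMPONENTS** (`1 + γ_j ∈ O^×`, `δ ∈ O^×`). [cite: Jacobowitz1962, §4] -/
theorem symmFactor_units (hγ : ∀ i, γ i ∈ O) (hγ1u : ∀ i, ∃ y ∈ O, y * (1 + γ i) = 1) {δ : K} (hδ : δ ∈ O) (hδu : ∃ y ∈ O, y * δ = 1) (i : Fin n) :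
    ∃ y ∈ O, y * ∏ j ∈ univ.erase i, ((1 + γ i) * (1 + γ j) * δ) = 1 := by
  classical
  -- a finite product of elements of `O` with inverses in `O` has an inverse in `O`
  have key : ∀ (s : Finset (Fin n)) (f : Fin n → K), (∀ j ∈ s, f j ∈ O ∧ ∃ y ∈ O, y * f j = 1) → ∃ y ∈ O, y * ∏ j ∈ s, f j = 1 := by
    intro s f hf
    induction s using Finset.induction_on with
    | empty => exact ⟨1, O.one_mem, by simp⟩
    | insert a s ha ih =>
      obtain ⟨y, hy, hy1⟩ := ih fun j hj => hf j (Finset.mem_insert_of_mem hj)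
      obtain ⟨-, z, hz, hz1⟩ := hf a (Finset.mem_insert_self a s)
      refine ⟨z * y, O.mul_mem hz hy, ?_⟩
      rw [Finset.prod_insert ha]
      linear_combination (∏ j ∈ s, f j) * y * hz1 + hy1
  refine key (univ.erase i) _ fun j _ => ⟨O.mul_mem (O.mul_mem (O.add_mem O.one_mem (hγ i)) (O.add_mem O.one_mem (hγ j))) hδ, ?_⟩
  obtain ⟨yi, hyi, hyi1⟩ := hγ1u i
  obtain ⟨yj, hyj, hyj1⟩ := hγ1u j
  obtain ⟨yd, hyd, hyd1⟩ := hδu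
  exact ⟨yi * yj * yd, O.mul_mem (O.mul_mem hyi hyj) hyd, by linear_combination (yj * (1 + γ j)) * (yd * δ) * hyi1 + (yd * δ) * hyj1 + hyd1⟩

end Symmetrisation

/-! ## §2 The criterion vector through the symmetrisation: `T(a) = (d · N(a) · s) · λ`, and O8a-∃ from the norm equations -/

section Criterion

variable {K : Type*} [Field K] {n : ℕ} (O : Subring K) (σ : K →+* K) {γ : Fin n → K}

/-- **`T(a) = (d_i · a_iσ(a_i) · s_i)_i · λ`** (pointwise rearrangement of `f′ = s·λ`). [cite: Jacobowitz1962, §4] -/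
theorem criterion_eq_normSymm_mul {δ : K} (hδ0 : δ ≠ 0) (hγ1 : ∀ i, 1 + γ i ≠ 0) (d a : Fin n → K) :
    (fun i => d i * a i * σ (a i) * ∏ j ∈ univ.erase i, (γ i - γ j)) =
      (fun i => d i * (a i * σ (a i)) * ∏ j ∈ univ.erase i, (γ i - γ j) / ((1 + γ i) * (1 + γ j) * δ)) *
        fun i => ∏ j ∈ univ.erase i, ((1 + γ i) * (1 + γ j) * δ) := by
  funext i
  rw [Pi.mul_apply, nodalDeriv_eq_symm_mul hδ0 hγ1 i]
  ring

/-- **O8a-∃ (abstract norm hypothesis): THE GOOD SET IS NON-EMPTY** when the `n` norm equations `a_i σ(a_i) · (d_i s_i) = 1` are solvable: then `T(a) = λ ∈ R` with unit components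
(`γ` norm-one nodes in `O` with `1 + γ_i ∈ O^×`, `δ ∈ O^×` skew).  At an unramified place the equations are solvable iff `v(d_i) + v(f′(γ)_i)` is even (§3).
[cite: Jacobowitz1962, §4] [cite: Serre1979, Ch. V §2 Prop. 3] -/
theorem exists_criterion_of_norm_solutions (hγ : ∀ i, γ i ∈ O) (hγ1u : ∀ i, ∃ y ∈ O, y * (1 + γ i) = 1)
    {δ : K} (hδ : δ ∈ O) (hδu : ∃ y ∈ O, y * δ = 1) (d a : Fin n → K)
    (ha : ∀ i, a i * σ (a i) * (d i * ∏ j ∈ univ.erase i, (γ i - γ j) / ((1 + γ i) * (1 + γ j) * δ)) = 1) :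
    (fun i => d i * a i * σ (a i) * ∏ j ∈ univ.erase i, (γ i - γ j)) ∈ Submodule.span O (Set.range fun j : Fin n => fun i => γ i ^ (j : ℕ)) ∧
      ∀ i, ∃ y ∈ O, y * (d i * a i * σ (a i) * ∏ j ∈ univ.erase i, (γ i - γ j)) = 1 := by
  have hγ1 : ∀ i, 1 + γ i ≠ 0 := fun i h0 => by
    obtain ⟨y, -, hy⟩ := hγ1u i; rw [h0, mul_zero] at hy; exact zero_ne_one hy
  have hδ0 : δ ≠ 0 := fun h0 => by obtain ⟨y, -, hy⟩ := hδu; rw [h0, mul_zero] at hy; exact zero_ne_one hy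
  have hfirst : (fun i => d i * (a i * σ (a i)) * ∏ j ∈ univ.erase i, (γ i - γ j) / ((1 + γ i) * (1 + γ j) * δ)) = 1 := by
    funext i
    rw [Pi.one_apply]
    linear_combination ha i
  have hT : (fun i => d i * a i * σ (a i) * ∏ j ∈ univ.erase i, (γ i - γ j)) = fun i => ∏ j ∈ univ.erase i, ((1 + γ i) * (1 + γ j) * δ) := by
    rw [criterion_eq_normSymm_mul σ hδ0 hγ1 d a, hfirst, one_mul]
  refine ⟨?_, fun i => ?_⟩
  · rw [hT]; exact symmFactor_mem_span_pow O hγ hγ1u hδ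
  · have h : d i * a i * σ (a i) * ∏ j ∈ univ.erase i, (γ i - γ j) = ∏ j ∈ univ.erase i, ((1 + γ i) * (1 + γ j) * δ) := congrFun hT i
    rw [h]
    exact symmFactor_units O hγ hγ1u hδ hδu i

/-- **CONVERSE**: a good `a` (criterion vector with unit components — no membership needed) makes every `d_i s_i · a_iσ(a_i)` a unit of `O`; so at an unramified place
`v(d_i) + v(f′(γ)_i) = v(d_i s_i)` is even (norms have even valuation). [cite: Serre1979, Ch. V §2 Prop. 3 Corollary] -/
theorem isUnit_normSymm_of_criterion (hγ : ∀ i, γ i ∈ O) (hγ1u : ∀ i, ∃ y ∈ O, y * (1 + γ i) = 1)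
    {δ : K} (hδ : δ ∈ O) (hδu : ∃ y ∈ O, y * δ = 1) (d a : Fin n → K)
    (hTO : ∀ i, d i * a i * σ (a i) * ∏ j ∈ univ.erase i, (γ i - γ j) ∈ O)
    (hTu : ∀ i, ∃ y ∈ O, y * (d i * a i * σ (a i) * ∏ j ∈ univ.erase i, (γ i - γ j)) = 1) (i : Fin n) :
    a i * σ (a i) * (d i * ∏ j ∈ univ.erase i, (γ i - γ j) / ((1 + γ i) * (1 + γ j) * δ)) ∈ O ∧
      ∃ y ∈ O, y * (a i * σ (a i) * (d i * ∏ j ∈ univ.erase i, (γ i - γ j) / ((1 + γ i) * (1 + γ j) * δ))) = 1 := by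
  have hγ1 : ∀ i, 1 + γ i ≠ 0 := fun i h0 => by
    obtain ⟨y, -, hy⟩ := hγ1u i; rw [h0, mul_zero] at hy; exact zero_ne_one hy
  have hδ0 : δ ≠ 0 := fun h0 => by obtain ⟨y, -, hy⟩ := hδu; rw [h0, mul_zero] at hy; exact zero_ne_one hy
  obtain ⟨yl, hyl, hyl1⟩ := symmFactor_units O hγ hγ1u hδ hδu i
  have hlO : ∏ j ∈ univ.erase i, ((1 + γ i) * (1 + γ j) * δ) ∈ O :=
    Subring.prod_mem _ fun j _ => O.mul_mem (O.mul_mem (O.add_mem O.one_mem (hγ i)) (O.add_mem O.one_mem (hγ j))) hδ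
  -- `N_i := d_i N(a_i) s_i = T(a)_i · yl`
  have hN : a i * σ (a i) * (d i * ∏ j ∈ univ.erase i, (γ i - γ j) / ((1 + γ i) * (1 + γ j) * δ)) =
      (d i * a i * σ (a i) * ∏ j ∈ univ.erase i, (γ i - γ j)) * yl := by
    have h := congrFun (criterion_eq_normSymm_mul σ hδ0 hγ1 d a) i
    rw [Pi.mul_apply] at h
    linear_combination (-yl) * h - (d i * (a i * σ (a i)) * ∏ j ∈ univ.erase i, (γ i - γ j) / ((1 + γ i) * (1 + γ j) * δ)) * hyl1
  rw [hN]
  obtain ⟨yT, hyT, hyT1⟩ := hTu i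
  refine ⟨O.mul_mem (hTO i) hyl, yT * ∏ j ∈ univ.erase i, ((1 + γ i) * (1 + γ j) * δ), O.mul_mem hyT hlO, ?_⟩
  linear_combination (∏ j ∈ univ.erase i, ((1 + γ i) * (1 + γ j) * δ)) * yl * hyT1 + hyl1

end Criterion

/-! ## §3 The norm equations at an unramified place (`ValuativeRel` currency of (D0)): σ-fixed elements of even valuation are norms -/

section Inert

open ValuativeRel Literature.NumberTheory.LocalFields.UnramifiedQuadraticNorm

variable {E : Type*} [Field E] [ValuativeRel E] (σ : E →+* E)

/-- **σ-FIXED ELEMENTS OF EVEN VALUATION ARE NORMS** at an inert place: `σ` an involution preserving `𝒪[E]` and moving some integer by a unit (`σ̄ ≠ id`), `E` a local field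
(`𝒪[E]` complete with finite residue field), `ϖ` σ-fixed; then a σ-fixed `x` with `v(x) = v(ϖ^{2k})` is `b σ(b)` (`x = ϖ^{2k} u`, `u` a σ-fixed unit `= t σ t` by ★ «`U_K = N U_L`»,
`b := ϖ^k t`). [cite: Serre1979, Ch. V §2 Prop. 3, Corollary and Remark 1] -/
theorem exists_mul_map_eq_of_valuation_eq_even [UniformSpace E] [IsUniformAddGroup E] [IsNonarchimedeanLocalField E] (hσσ : ∀ x, σ (σ x) = x) (hσO : ∀ x : 𝒪[E], σ x ∈ 𝒪[E])
    (hmove : ∃ a : 𝒪[E], IsUnit ((⟨σ a, hσO a⟩ : 𝒪[E]) - a)) {ϖ : E} (hϖ0 : ϖ ≠ 0) (hσϖ : σ ϖ = ϖ)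
    {x : E} (hσx : σ x = x) (k : ℕ) (hx : valuation E x = valuation E (ϖ ^ (2 * k))) :
    ∃ b : E, b * σ b = x := by
  have hϖk : ϖ ^ (2 * k) ≠ 0 := pow_ne_zero _ hϖ0
  have hvx : valuation E (x / ϖ ^ (2 * k)) = 1 := by rw [map_div₀, hx, div_self ((Valuation.ne_zero_iff _).2 hϖk)]
  have hx0 : x ≠ 0 := fun h0 => by
    rw [h0, map_zero] at hx
    exact (Valuation.ne_zero_iff _).2 hϖk hx.symm
  -- the unit `u := x / ϖ^{2k}` of `𝒪[E]`
  have huO : x / ϖ ^ (2 * k) ∈ 𝒪[E] := (Valuation.mem_integer_iff _ _).2 hvx.le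
  set u : 𝒪[E] := ⟨x / ϖ ^ (2 * k), huO⟩ with hudef
  have hu : IsUnit u := (Valuation.integer.integers (valuation E)).isUnit_iff_valuation_eq_one.2 hvx
  have hσu : σ u = u := by
    show σ (x / ϖ ^ (2 * k)) = x / ϖ ^ (2 * k)
    rw [map_div₀, hσx, map_pow, hσϖ]
  obtain ⟨t, ht⟩ := exists_mul_map_eq_of_isUnit_integer σ hσσ hσO hmove u hu hσu
  refine ⟨ϖ ^ k * t, ?_⟩
  have ht' : (t : E) * σ t = x / ϖ ^ (2 * k) := ht
  rw [map_mul, map_pow, hσϖ, show ϖ ^ k * (t : E) * (ϖ ^ k * σ t) = (ϖ ^ k * ϖ ^ k) * ((t : E) * σ t) by ring, ht', ← pow_add,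
    show k + k = 2 * k by ring, mul_div_cancel₀ _ hϖk]

/-- **THE NORM EQUATIONS FROM PARITY (O8a-∃ at an inert place)**: with `c := d · s` σ-fixed and `v(c) = v(ϖ^{2k})` (i.e. `v(d) + v(f′(γ)) ≡ 0 mod 2`, `λ` being a unit), there is
`a` with `a σ(a) · c = 1`. [cite: Serre1979, Ch. V §2 Prop. 3, Corollary and Remark 1] -/
theorem exists_norm_solution_of_even [UniformSpace E] [IsUniformAddGroup E] [IsNonarchimedeanLocalField E] (hσσ : ∀ x, σ (σ x) = x) (hσO : ∀ x : 𝒪[E], σ x ∈ 𝒪[E])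
    (hmove : ∃ a : 𝒪[E], IsUnit ((⟨σ a, hσO a⟩ : 𝒪[E]) - a)) {ϖ : E} (hϖ0 : ϖ ≠ 0) (hσϖ : σ ϖ = ϖ)
    {c : E} (hσc : σ c = c) (k : ℕ) (hc : valuation E c = valuation E (ϖ ^ (2 * k))) :
    ∃ a : E, a * σ a * c = 1 := by
  obtain ⟨b, hb⟩ := exists_mul_map_eq_of_valuation_eq_even σ hσσ hσO hmove hϖ0 hσϖ hσc k hc
  have hc0 : c ≠ 0 := fun h0 => by
    rw [h0, map_zero] at hc
    exact (Valuation.ne_zero_iff _).2 (pow_ne_zero _ hϖ0) hc.symm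
  have hb0 : b ≠ 0 := fun h0 => hc0 (by rw [← hb, h0, zero_mul])
  have hσb0 : σ b ≠ 0 := fun h0 => hc0 (by rw [← hb, h0, mul_zero])
  refine ⟨b⁻¹, ?_⟩
  rw [map_inv₀, ← hb]
  field_simp

/-- **THE `zpow` TWIN** (head reader ref5 R-11 (iv): the parity class has no sign): a σ-fixed `x` with `v(x) = v(ϖ^{2k})`, `k : ℤ`, is a norm `b σ(b)`.
[cite: Serre1979, Ch. V §2 Prop. 3, Corollary and Remark 1] -/
theorem exists_mul_map_eq_of_valuation_eq_zpow_even [UniformSpace E] [IsUniformAddGroup E] [IsNonarchimedeanLocalField E]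
    (hσσ : ∀ x, σ (σ x) = x) (hσO : ∀ x : 𝒪[E], σ x ∈ 𝒪[E])
    (hmove : ∃ a : 𝒪[E], IsUnit ((⟨σ a, hσO a⟩ : 𝒪[E]) - a)) {ϖ : E} (hϖ0 : ϖ ≠ 0) (hσϖ : σ ϖ = ϖ)
    {x : E} (hσx : σ x = x) (k : ℤ) (hx : valuation E x = valuation E (ϖ ^ (2 * k))) :
    ∃ b : E, b * σ b = x := by
  have hϖk : ϖ ^ (2 * k) ≠ 0 := zpow_ne_zero _ hϖ0
  have hvx : valuation E (x / ϖ ^ (2 * k)) = 1 := by rw [map_div₀, hx, div_self ((Valuation.ne_zero_iff _).2 hϖk)]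
  have huO : x / ϖ ^ (2 * k) ∈ 𝒪[E] := (Valuation.mem_integer_iff _ _).2 hvx.le
  set u : 𝒪[E] := ⟨x / ϖ ^ (2 * k), huO⟩ with hudef
  have hu : IsUnit u := (Valuation.integer.integers (valuation E)).isUnit_iff_valuation_eq_one.2 hvx
  have hσu : σ u = u := by
    show σ (x / ϖ ^ (2 * k)) = x / ϖ ^ (2 * k)
    rw [map_div₀, hσx, map_zpow₀, hσϖ]
  obtain ⟨t, ht⟩ := exists_mul_map_eq_of_isUnit_integer σ hσσ hσO hmove u hu hσu
  refine ⟨ϖ ^ k * t, ?_⟩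
  have ht' : (t : E) * σ t = x / ϖ ^ (2 * k) := ht
  rw [map_mul, map_zpow₀, hσϖ, show ϖ ^ k * (t : E) * (ϖ ^ k * σ t) = (ϖ ^ k * ϖ ^ k) * ((t : E) * σ t) by ring, ht', ← zpow_add₀ hϖ0,
    show k + k = 2 * k by ring, mul_div_cancel₀ _ hϖk]

/-- **THE NORM EQUATIONS FROM PARITY, `zpow` TWIN**: `σ c = c`, `v(c) = v(ϖ^{2k})` with `k : ℤ` ⇒ `∃ a, a σ(a) · c = 1`. [cite: Serre1979, Ch. V §2 Prop. 3, Corollary and Remark 1] -/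
theorem exists_norm_solution_of_zpow_even [UniformSpace E] [IsUniformAddGroup E] [IsNonarchimedeanLocalField E]
    (hσσ : ∀ x, σ (σ x) = x) (hσO : ∀ x : 𝒪[E], σ x ∈ 𝒪[E])
    (hmove : ∃ a : 𝒪[E], IsUnit ((⟨σ a, hσO a⟩ : 𝒪[E]) - a)) {ϖ : E} (hϖ0 : ϖ ≠ 0) (hσϖ : σ ϖ = ϖ)
    {c : E} (hσc : σ c = c) (k : ℤ) (hc : valuation E c = valuation E (ϖ ^ (2 * k))) :
    ∃ a : E, a * σ a * c = 1 := by
  obtain ⟨b, hb⟩ := exists_mul_map_eq_of_valuation_eq_zpow_even σ hσσ hσO hmove hϖ0 hσϖ hσc k hc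
  have hc0 : c ≠ 0 := fun h0 => by
    rw [h0, map_zero] at hc
    exact (Valuation.ne_zero_iff _).2 (zpow_ne_zero _ hϖ0) hc.symm
  have hb0 : b ≠ 0 := fun h0 => hc0 (by rw [← hb, h0, zero_mul])
  have hσb0 : σ b ≠ 0 := fun h0 => hc0 (by rw [← hb, h0, mul_zero])
  refine ⟨b⁻¹, ?_⟩
  rw [map_inv₀, ← hb]
  field_simp

end Inert

end Literature.NumberTheory.Automorphic
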